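import Summits.ValiantsHypothesis.ValiantsHypothesis.Theorems.BarrierLeverPartitionMinorsChowIntegerCertificates

/-!
# Route BarrierLever — Chow witnesses for partition minors (item 20172, CPM): EVERY PRODUCT-STATE
# TABLE IS A CHOW TABLE — single product states (arbitrary `2 × 2` site tables, any pairing) are
# realised by products of `h + h` affine forms; translates / automorphic layouts are Chow-hit

Helper file (`--supports stmt-ValiantsHypothesis-20172`; cell valiant-natproofs, rung V4, 𝒟-side of
door (c); seat valiant-natproofs-prover gen 12).  Closes NO item; definition-free.

Conventions of items 19717 / 20172 / 20195: `x_a = X (Fin.castAdd h a)`, `y_c = X (Fin.natAdd h c)`,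
`E u w = Σ_{a∈u} e_{x_a} + Σ_{c∈w} e_{y_c}`; a layout `(u, w)` (`u w : Fin r → Finset (Fin h)`) is
CHOW-HIT when some product of `h + h` affine forms `ℓ_k` has `det[coeff_{E (u i) (w j)} ∏ ℓ] ≠ 0`.

A (single) PRODUCT STATE with pairing `π` and site tables `m a : Bool → Bool → ℂ` is
`∏_a Σ_{ε,η} m a ε η · x_a^ε y_{π a}^η`; its partition matrix is `(u, w) ↦ ∏_a m a [a ∈ u] [π a ∈ w]`
(tree: `ProductStatesC.coeff_prodStateC`, the witness family of several item-19717 classes).  A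
product state is NOT a product of affine forms — but its TABLE is a Chow table:

* `exists_affinePair_of_table` — every `2 × 2` complex table `t` is the multilinear table of a
  product of TWO affine forms in two variables: `(c₁ + α x + β y)(c₂ + γ x + δ y)` has
  `(1, y, x, xy)`-coefficients `(c₁c₂, c₁δ + βc₂, c₁γ + αc₂, αδ + βγ) = (t₀₀, t₀₁, t₁₀, t₁₁)` for an
  explicit choice (six cases on the vanishing of `t₀₀, t₀₁, t₁₀`); the spurious `x², y²` terms never
  meet a multilinear coefficient.
* `coeff_partitionExpo_prod_pairedSites` — for paired affine forms `ℓ¹_a, ℓ²_a` in `(x_a, y_{π a})`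
  realising tables `m a`: `coeff_{E u w} ∏_a ℓ¹_a ℓ²_a = ∏_a m a [a ∈ u] [π a ∈ w]` (induction over
  the sites with the one-factor rule `coeff_partitionExpo_mul_pairedAffine`).
* `chow_hit_of_siteTables` — **THE TRANSFER**: if `det[∏_a m a [a ∈ u i] [π a ∈ w j]] ≠ 0` for some
  tables and pairing, the layout is Chow-hit.  So every class of item 19717 obtained from ONE product
  state is a class of item 20172 as well (the width-one case of the tensor-train / ROABP door lies
  inside CPM).
* `chow_hit_of_automorphicTranslate` — the AUTOMORPHIC layouts `w j = σ (u (κ j) ∆ s)` (cube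
  automorphism: coordinate permutation `σ` after translation by `s`; rows distinct; cf.
  `ProductStateSums.partitionMinor_hit_of_automorphic` for item 19717) are Chow-hit at every height
  and size: tables `m a = [η = ε ⊻ (a ∈ s)]` make the matrix the permutation matrix of `κ`.

WHAT THIS IS NOT: single product states only (sums of product states are not Chow tables — they are
exactly what the capacity barrier `…ProductStateRankBound` kills); nothing on items 20172 / 20195 /
19717 themselves, on crux stmt-ValiantsHypothesis-14610, or on `VP` versus `VNP`.
-/

set_option linter.dupNamespace false

namespace Summit.ValiantsHypothesis.ValiantsHypothesis.Theorems.BarrierLever.ChowFactor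

open Finset MvPolynomial

noncomputable section

variable {h : ℕ}

/-! ## 1. Every `2 × 2` table is the multilinear table of a product of two affine forms -/

/-- **Every `2 × 2` complex table is realised by two affine forms**: there are
`c₁, α, β, c₂, γ, δ` with `(c₁ + αx + βy)(c₂ + γx + δy) ≡ t₀₀ + t₀₁ y + t₁₀ x + t₁₁ xy (mod x², y²)`. -/
theorem exists_affinePair_of_table (t : Bool → Bool → ℂ) :
    ∃ c₁ α β c₂ γ δ : ℂ, c₁ * c₂ = t false false ∧ c₁ * δ + β * c₂ = t false true ∧
      c₁ * γ + α * c₂ = t true false ∧ α * δ + β * γ = t true true := by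
  by_cases h00 : t false false = 0
  · by_cases h10 : t true false = 0
    · by_cases h01 : t false true = 0
      · -- `t = (0, 0, 0, t₁₁)`: `x · (t₁₁ y)`
        exact ⟨0, 1, 0, 0, 0, t true true, by simp [h00], by simp [h01], by simp [h10], by simp⟩
      · -- `t₀₀ = t₁₀ = 0`, `t₀₁ ≠ 0`: `(t₀₁ y) · (1 + (t₁₁/t₀₁) x)`
        refine ⟨0, 0, t false true, 1, t true true / t false true, 0, by simp [h00], by simp,
          by simp [h10], ?_⟩
        rw [zero_mul, zero_add, mul_div_cancel₀ _ h01]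
    · -- `t₀₀ = 0`, `t₁₀ ≠ 0`: `(t₁₀ x + t₀₁ y) · (1 + (t₁₁/t₁₀) y)`
      refine ⟨0, t true false, t false true, 1, 0, t true true / t true false, by simp [h00], by simp,
        by simp, ?_⟩
      rw [mul_zero, add_zero, mul_div_cancel₀ _ h10]
  · by_cases h01 : t false true = 0
    · by_cases h10 : t true false = 0
      · -- `t = (t₀₀, 0, 0, t₁₁)`, `t₀₀ ≠ 0`: `(t₀₀ − t₀₀ x + (t₁₁/2) y) · (1 + x − (t₁₁/(2t₀₀)) y)`
        refine ⟨t false false, -t false false, t true true / 2, 1, 1,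
          -(t true true / (2 * t false false)), by simp, ?_, ?_, ?_⟩
        · rw [h01]; field_simp; ring
        · rw [h10]; ring
        · field_simp; ring
      · -- `t₀₁ = 0`, `t₀₀, t₁₀ ≠ 0`: `(t₀₀ + β y) · (1 + (t₁₀/t₀₀) x − (t₁₁/t₁₀) y)`, `β = t₁₁ t₀₀ / t₁₀`
        refine ⟨t false false, 0, t true true * t false false / t true false, 1,
          t true false / t false false, -(t true true / t true false), by simp, ?_, ?_, ?_⟩
        · rw [h01]; ring
        · rw [zero_mul, add_zero, mul_div_cancel₀ _ h00]
        · rw [zero_mul, zero_add]; field_simp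
    · -- `t₀₀, t₀₁ ≠ 0`: `(t₀₀ + α x) · (1 + γ x + (t₀₁/t₀₀) y)`, `α = t₁₁ t₀₀ / t₀₁`,
      -- `γ = t₁₀/t₀₀ − t₁₁/t₀₁`
      refine ⟨t false false, t true true * t false false / t false true, 0, 1,
        t true false / t false false - t true true / t false true,
        t false true / t false false, by simp, ?_, ?_, ?_⟩
      · rw [zero_mul, add_zero, mul_div_cancel₀ _ h00]
      · rw [mul_sub, mul_div_cancel₀ _ h00]; ring
      · rw [zero_mul, add_zero]; field_simp

/-! ## 2. One paired affine factor, and the table of a product of paired sites -/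

/-- Multiplying by an affine form in `x_a, y_c` only:
`coeff_{E u w}(f·(k + α x_a + β y_c)) = k·coeff_{E u w} f + [a∈u] α·coeff_{E (u∖a) w} f
+ [c∈w] β·coeff_{E u (w∖c)} f`. -/
theorem coeff_partitionExpo_mul_pairedAffine {R : Type*} [CommSemiring R]
    (f : MvPolynomial (Fin (h + h)) R) (a c : Fin h) (k α β : R) (u w : Finset (Fin h)) :
    coeff (∑ b ∈ u, Finsupp.single (Fin.castAdd h b) 1 + ∑ d ∈ w, Finsupp.single (Fin.natAdd h d) 1)
        (f * (C k + C α * X (Fin.castAdd h a) + C β * X (Fin.natAdd h c))) =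
      k * coeff (∑ b ∈ u, Finsupp.single (Fin.castAdd h b) 1 +
          ∑ d ∈ w, Finsupp.single (Fin.natAdd h d) 1) f +
        (if a ∈ u then α * coeff (∑ b ∈ u.erase a, Finsupp.single (Fin.castAdd h b) 1 +
          ∑ d ∈ w, Finsupp.single (Fin.natAdd h d) 1) f else 0) +
        (if c ∈ w then β * coeff (∑ b ∈ u, Finsupp.single (Fin.castAdd h b) 1 +
          ∑ d ∈ w.erase c, Finsupp.single (Fin.natAdd h d) 1) f else 0) := by
  classical
  rw [mul_add, mul_add, coeff_add, coeff_add]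
  congr 1
  · congr 1
    · rw [mul_comm, coeff_C_mul]
    · rw [mul_left_comm, coeff_C_mul, coeff_mul_X']
      by_cases ha : a ∈ u
      · rw [if_pos ((castAdd_mem_support_partitionExpo u w a).mpr ha),
          partitionExpo_tsub_single_castAdd, if_pos ha]
      · rw [if_neg (fun hm => ha ((castAdd_mem_support_partitionExpo u w a).mp hm)), if_neg ha,
          mul_zero]
  · rw [mul_left_comm, coeff_C_mul, coeff_mul_X']
    by_cases hc : c ∈ w
    · rw [if_pos ((natAdd_mem_support_partitionExpo u w c).mpr hc), partitionExpo_tsub_single,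
        if_pos hc]
    · rw [if_neg (fun hm => hc ((natAdd_mem_support_partitionExpo u w c).mp hm)), if_neg hc,
        mul_zero]

/-- Sites away from `a` do not see whether `a` was erased from the row. -/
theorem prod_table_erase_row {S : Finset (Fin h)} {a : Fin h} (haS : a ∉ S) (π : Equiv.Perm (Fin h))
    (m : Fin h → Bool → Bool → ℂ) (u z : Finset (Fin h)) :
    (∏ a' ∈ S, m a' (decide (a' ∈ u.erase a)) (decide (π a' ∈ z))) =
      ∏ a' ∈ S, m a' (decide (a' ∈ u)) (decide (π a' ∈ z)) := by
  refine Finset.prod_congr rfl fun a' ha' => ?_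
  have hne : a' ≠ a := fun e => haS (e ▸ ha')
  simp [Finset.mem_erase, hne]

/-- Sites away from `a` do not see whether `π a` was erased from the column. -/
theorem prod_table_erase_col {S : Finset (Fin h)} {a : Fin h} (haS : a ∉ S) (π : Equiv.Perm (Fin h))
    (m : Fin h → Bool → Bool → ℂ) (v w : Finset (Fin h)) :
    (∏ a' ∈ S, m a' (decide (a' ∈ v)) (decide (π a' ∈ w.erase (π a)))) =
      ∏ a' ∈ S, m a' (decide (a' ∈ v)) (decide (π a' ∈ w)) := by
  refine Finset.prod_congr rfl fun a' ha' => ?_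
  have hne : π a' ≠ π a := fun e => haS (π.injective e ▸ ha')
  simp [Finset.mem_erase, hne]

/-- **The table of a product of paired sites** (partial product over a set `S` of sites): if the
affine pairs `(c₁ a + α a x_a + β a y_{π a}) (c₂ a + γ a x_a + δ a y_{π a})` realise the tables `m a`,
then `coeff_{E u w} ∏_{a ∈ S} (pair a) = [u ⊆ S, w ⊆ π S] · ∏_{a∈S} m a [a ∈ u] [π a ∈ w]`. -/
theorem coeff_partitionExpo_prod_pairedSites_subset (π : Equiv.Perm (Fin h))
    (c₁ α β c₂ γ δ : Fin h → ℂ) (m : Fin h → Bool → Bool → ℂ)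
    (h00 : ∀ a, c₁ a * c₂ a = m a false false) (h01 : ∀ a, c₁ a * δ a + β a * c₂ a = m a false true)
    (h10 : ∀ a, c₁ a * γ a + α a * c₂ a = m a true false) (h11 : ∀ a, α a * δ a + β a * γ a = m a true true)
    (S : Finset (Fin h)) (u w : Finset (Fin h)) :
    coeff (∑ b ∈ u, Finsupp.single (Fin.castAdd h b) 1 + ∑ d ∈ w, Finsupp.single (Fin.natAdd h d) 1)
        (∏ a ∈ S, ((C (c₁ a) + C (α a) * X (Fin.castAdd h a) + C (β a) * X (Fin.natAdd h (π a))) *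
          (C (c₂ a) + C (γ a) * X (Fin.castAdd h a) + C (δ a) * X (Fin.natAdd h (π a))) :
            MvPolynomial (Fin (h + h)) ℂ)) =
      if u ⊆ S ∧ w ⊆ S.map π.toEmbedding then
        ∏ a ∈ S, m a (decide (a ∈ u)) (decide (π a ∈ w)) else 0 := by
  classical
  induction S using Finset.induction_on generalizing u w with
  | empty =>
    rw [Finset.prod_empty, coeff_partitionExpo_one, Finset.prod_empty, Finset.map_empty]
    simp only [Finset.subset_empty]
  | insert a S haS ih =>
    rw [Finset.prod_insert haS, mul_comm, ← mul_assoc, coeff_partitionExpo_mul_pairedAffine,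
      coeff_partitionExpo_mul_pairedAffine, coeff_partitionExpo_mul_pairedAffine,
      coeff_partitionExpo_mul_pairedAffine]
    simp only [ih, Finset.notMem_erase, ↓reduceIte, add_zero]
    -- vanishing of the old closed form on rows through `a` / columns through `π a`
    have hπS : π a ∉ S.map π.toEmbedding := fun hm => haS (by simpa using hm)
    have vrow : ∀ v z : Finset (Fin h), a ∈ v → ¬ (v ⊆ S ∧ z ⊆ S.map π.toEmbedding) :=
      fun v z hav hh => haS (hh.1 hav)
    have vcol : ∀ v z : Finset (Fin h), π a ∈ z → ¬ (v ⊆ S ∧ z ⊆ S.map π.toEmbedding) :=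
      fun v z haz hh => hπS (hh.2 haz)
    -- the new condition, uniformly: `u ⊆ insert a S ∧ w ⊆ π (insert a S)` iff the erased sets fit
    have key : (u ⊆ insert a S ∧ w ⊆ (insert a S).map π.toEmbedding) ↔
        (u.erase a ⊆ S ∧ w.erase (π a) ⊆ S.map π.toEmbedding) := by
      rw [Finset.map_insert, Equiv.toEmbedding_apply, Finset.subset_insert_iff,
        Finset.subset_insert_iff]
    rw [Finset.prod_insert haS]
    simp only [prod_table_erase_row haS, prod_table_erase_col haS]
    by_cases hau : a ∈ u
    · by_cases haw : π a ∈ w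
      · -- both variables of the site are used: only the doubly-erased term survives
        simp only [hau, haw, ↓reduceIte, decide_true, if_neg (vrow u w hau),
          if_neg (vrow u (w.erase (π a)) hau), if_neg (vcol (u.erase a) w haw), mul_zero, zero_add,
          add_zero]
        by_cases hg : u.erase a ⊆ S ∧ w.erase (π a) ⊆ S.map π.toEmbedding
        · rw [if_pos hg, if_pos (key.mpr hg), ← h11 a]; ring
        · rw [if_neg hg, if_neg (fun hh => hg (key.mp hh))]; ring
      · have hwe : w.erase (π a) = w := Finset.erase_eq_of_notMem haw
        simp only [hau, haw, ↓reduceIte, decide_true, decide_false, if_neg (vrow u w hau),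
          mul_zero, zero_add, add_zero]
        rw [hwe] at key
        by_cases hg : u.erase a ⊆ S ∧ w ⊆ S.map π.toEmbedding
        · rw [if_pos hg, if_pos (key.mpr hg), ← h10 a]; ring
        · rw [if_neg hg, if_neg (fun hh => hg (key.mp hh))]; ring
    · have hue : u.erase a = u := Finset.erase_eq_of_notMem hau
      rw [hue] at key
      by_cases haw : π a ∈ w
      · simp only [hau, haw, ↓reduceIte, decide_true, decide_false, if_neg (vcol u w haw),
          mul_zero, zero_add, add_zero]
        by_cases hg : u ⊆ S ∧ w.erase (π a) ⊆ S.map π.toEmbedding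
        · rw [if_pos hg, if_pos (key.mpr hg), ← h01 a]; ring
        · rw [if_neg hg, if_neg (fun hh => hg (key.mp hh))]; ring
      · have hwe : w.erase (π a) = w := Finset.erase_eq_of_notMem haw
        rw [hwe] at key
        simp only [hau, haw, ↓reduceIte, decide_false, add_zero]
        by_cases hg : u ⊆ S ∧ w ⊆ S.map π.toEmbedding
        · rw [if_pos hg, if_pos (key.mpr hg), ← h00 a]; ring
        · rw [if_neg hg, if_neg (fun hh => hg (key.mp hh))]; ring

/-- **The table of a product of paired sites**, all sites: `coeff_{E u w} ∏_a (pair a) =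
∏_a m a [a ∈ u] [π a ∈ w]` — the partition matrix of the corresponding product state. -/
theorem coeff_partitionExpo_prod_pairedSites (π : Equiv.Perm (Fin h))
    (c₁ α β c₂ γ δ : Fin h → ℂ) (m : Fin h → Bool → Bool → ℂ)
    (h00 : ∀ a, c₁ a * c₂ a = m a false false) (h01 : ∀ a, c₁ a * δ a + β a * c₂ a = m a false true)
    (h10 : ∀ a, c₁ a * γ a + α a * c₂ a = m a true false) (h11 : ∀ a, α a * δ a + β a * γ a = m a true true)
    (u w : Finset (Fin h)) :
    coeff (∑ b ∈ u, Finsupp.single (Fin.castAdd h b) 1 + ∑ d ∈ w, Finsupp.single (Fin.natAdd h d) 1)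
        (∏ a : Fin h, ((C (c₁ a) + C (α a) * X (Fin.castAdd h a) + C (β a) * X (Fin.natAdd h (π a))) *
          (C (c₂ a) + C (γ a) * X (Fin.castAdd h a) + C (δ a) * X (Fin.natAdd h (π a))) :
            MvPolynomial (Fin (h + h)) ℂ)) =
      ∏ a : Fin h, m a (decide (a ∈ u)) (decide (π a ∈ w)) := by
  rw [coeff_partitionExpo_prod_pairedSites_subset π c₁ α β c₂ γ δ m h00 h01 h10 h11, if_pos]
  exact ⟨Finset.subset_univ _, by rw [Finset.map_univ_equiv]; exact Finset.subset_univ _⟩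

/-! ## 3. The transfer: product-state tables are Chow tables -/

/-- **EVERY PRODUCT-STATE TABLE IS A CHOW TABLE.**  If, for some pairing `π` and site tables `m`, the
product-state matrix `(i, j) ↦ ∏_a m a [a ∈ u i] [π a ∈ w j]` of a layout is nonsingular, then the
layout is hit by a product of `h + h` affine forms (item 20172's conclusion for it). -/
theorem chow_hit_of_siteTables {r : ℕ} (u w : Fin r → Finset (Fin h)) (π : Equiv.Perm (Fin h))
    (m : Fin h → Bool → Bool → ℂ)
    (hdet : (Matrix.of fun i j : Fin r => ∏ a : Fin h, m a (decide (a ∈ u i)) (decide (π a ∈ w j))).det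
      ≠ 0) :
    ∃ ℓ : Fin (h + h) → MvPolynomial (Fin (h + h)) ℂ, (∀ q, (ℓ q).totalDegree ≤ 1) ∧
      (Matrix.of fun i j : Fin r => coeff
        (∑ b ∈ u i, Finsupp.single (Fin.castAdd h b) 1 + ∑ d ∈ w j, Finsupp.single (Fin.natAdd h d) 1)
        (∏ q, ℓ q)).det ≠ 0 := by
  classical
  choose c₁ α β c₂ γ δ hreal using fun a => exists_affinePair_of_table (m a)
  -- the `h + h` forms: first factors at `castAdd a`, second factors at `natAdd a`
  refine ⟨fun k => Fin.addCases (motive := fun _ => MvPolynomial (Fin (h + h)) ℂ)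
      (fun a => C (c₁ a) + C (α a) * X (Fin.castAdd h a) + C (β a) * X (Fin.natAdd h (π a)))
      (fun a => C (c₂ a) + C (γ a) * X (Fin.castAdd h a) + C (δ a) * X (Fin.natAdd h (π a))) k,
    fun k => ?_, ?_⟩
  · -- affine
    have haff : ∀ (k₀ a₀ b₀ : ℂ) (v₁ v₂ : Fin (h + h)),
        ((C k₀ + C a₀ * X v₁ + C b₀ * X v₂ : MvPolynomial (Fin (h + h)) ℂ)).totalDegree ≤ 1 := by
      intro k₀ a₀ b₀ v₁ v₂
      refine (totalDegree_add _ _).trans (max_le ((totalDegree_add _ _).trans (max_le ?_ ?_)) ?_)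
      · rw [totalDegree_C]; exact Nat.zero_le _
      · exact (totalDegree_mul _ _).trans (by
          rw [totalDegree_C, zero_add]; exact (isHomogeneous_X ℂ _).totalDegree_le)
      · exact (totalDegree_mul _ _).trans (by
          rw [totalDegree_C, zero_add]; exact (isHomogeneous_X ℂ _).totalDegree_le)
    refine Fin.addCases (fun a => ?_) (fun a => ?_) k
    · simp only [Fin.addCases_left]; exact haff _ _ _ _ _
    · simp only [Fin.addCases_right]; exact haff _ _ _ _ _
  · have hprod : (∏ k : Fin (h + h), Fin.addCases (motive := fun _ => MvPolynomial (Fin (h + h)) ℂ)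
        (fun a => C (c₁ a) + C (α a) * X (Fin.castAdd h a) + C (β a) * X (Fin.natAdd h (π a)))
        (fun a => C (c₂ a) + C (γ a) * X (Fin.castAdd h a) + C (δ a) * X (Fin.natAdd h (π a))) k) =
        ∏ a : Fin h, ((C (c₁ a) + C (α a) * X (Fin.castAdd h a) + C (β a) * X (Fin.natAdd h (π a))) *
          (C (c₂ a) + C (γ a) * X (Fin.castAdd h a) + C (δ a) * X (Fin.natAdd h (π a)))) := by
      rw [Fin.prod_univ_add, ← Finset.prod_mul_distrib]
      refine Finset.prod_congr rfl fun a _ => ?_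
      rw [Fin.addCases_left, Fin.addCases_right]
    have hM : (Matrix.of fun i j : Fin r => coeff
        (∑ b ∈ u i, Finsupp.single (Fin.castAdd h b) 1 + ∑ d ∈ w j, Finsupp.single (Fin.natAdd h d) 1)
        (∏ k : Fin (h + h), Fin.addCases (motive := fun _ => MvPolynomial (Fin (h + h)) ℂ)
          (fun a => C (c₁ a) + C (α a) * X (Fin.castAdd h a) + C (β a) * X (Fin.natAdd h (π a)))
          (fun a => C (c₂ a) + C (γ a) * X (Fin.castAdd h a) + C (δ a) * X (Fin.natAdd h (π a))) k)) =
        Matrix.of fun i j : Fin r => ∏ a : Fin h, m a (decide (a ∈ u i)) (decide (π a ∈ w j)) := by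
      ext i j
      rw [Matrix.of_apply, Matrix.of_apply, hprod,
        coeff_partitionExpo_prod_pairedSites π c₁ α β c₂ γ δ m (fun a => (hreal a).1)
          (fun a => (hreal a).2.1) (fun a => (hreal a).2.2.1) (fun a => (hreal a).2.2.2)]
    rw [hM]
    exact hdet

/-! ## 4. Automorphic layouts (translation, then coordinate permutation) are Chow-hit -/

/-- The table test of the twisted pairing: `∏_a [(σ a ∈ w) ↔ ((a ∈ u) ⊻ (a ∈ s))] = [w = σ (u ∆ s)]`. -/
theorem prod_twistTable_eq (σ : Equiv.Perm (Fin h)) (s u w : Finset (Fin h)) :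
    (∏ a : Fin h, (if decide (σ a ∈ w) = (decide (a ∈ u) ^^ decide (a ∈ s)) then (1 : ℂ) else 0)) =
      if w = (symmDiff u s).map σ.toEmbedding then 1 else 0 := by
  classical
  have hmem : ∀ a : Fin h, σ a ∈ (symmDiff u s).map σ.toEmbedding ↔ (a ∈ u ∧ a ∉ s ∨ a ∈ s ∧ a ∉ u) :=
    fun a => by rw [Finset.mem_map_equiv, Equiv.symm_apply_apply, Finset.mem_symmDiff]
  by_cases hw : w = (symmDiff u s).map σ.toEmbedding
  · rw [if_pos hw]
    refine Finset.prod_eq_one fun a _ => ?_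
    have hm := hmem a
    rw [← hw] at hm
    by_cases hu : a ∈ u <;> by_cases hs : a ∈ s
    · have hA : σ a ∉ w := fun hh => by rcases hm.mp hh with h1 | h1 <;> [exact h1.2 hs; exact h1.2 hu]
      simp [hA, hu, hs]
    · have hA : σ a ∈ w := hm.mpr (Or.inl ⟨hu, hs⟩)
      simp [hA, hu, hs]
    · have hA : σ a ∈ w := hm.mpr (Or.inr ⟨hs, hu⟩)
      simp [hA, hu, hs]
    · have hA : σ a ∉ w := fun hh => by rcases hm.mp hh with h1 | h1 <;> [exact hu h1.1; exact hs h1.1]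
      simp [hA, hu, hs]
  · rw [if_neg hw]
    -- some coordinate fails the test, else `w = σ (u ∆ s)`
    by_contra hne
    apply hw
    ext c
    rw [← σ.apply_symm_apply c, hmem (σ.symm c)]
    have hall : ∀ a : Fin h, decide (σ a ∈ w) = (decide (a ∈ u) ^^ decide (a ∈ s)) := by
      intro a
      by_contra hfa
      exact hne (Finset.prod_eq_zero (Finset.mem_univ a) (if_neg hfa))
    have hc := hall (σ.symm c)
    simp only [Equiv.apply_symm_apply] at hc
    by_cases hu : σ.symm c ∈ u <;> by_cases hs : σ.symm c ∈ s <;> simp [hu, hs] at hc ⊢ <;> exact hc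

/-- **AUTOMORPHIC LAYOUTS ARE CHOW-HIT, every height and size**: if the rows are distinct and the
columns are the image of a rearrangement of the rows under a cube automorphism,
`w j = σ (u (κ j) ∆ s)`, then some product of `h + h` affine forms has a nonsingular partition minor
on `(u, w)` — via the tables `m a ε η = [η = ε ⊻ (a ∈ s)]` paired by `σ`, whose matrix is the
permutation matrix of `κ`. -/
theorem chow_hit_of_automorphicTranslate {r : ℕ} (u w : Fin r → Finset (Fin h))
    (hu : Function.Injective u) (σ : Equiv.Perm (Fin h)) (s : Finset (Fin h)) (κ : Equiv.Perm (Fin r))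
    (hκ : ∀ j, w j = (symmDiff (u (κ j)) s).map σ.toEmbedding) :
    ∃ ℓ : Fin (h + h) → MvPolynomial (Fin (h + h)) ℂ, (∀ q, (ℓ q).totalDegree ≤ 1) ∧
      (Matrix.of fun i j : Fin r => coeff
        (∑ b ∈ u i, Finsupp.single (Fin.castAdd h b) 1 + ∑ d ∈ w j, Finsupp.single (Fin.natAdd h d) 1)
        (∏ q, ℓ q)).det ≠ 0 := by
  classical
  refine chow_hit_of_siteTables u w σ
    (fun a ε η => if η = (ε ^^ decide (a ∈ s)) then (1 : ℂ) else 0) ?_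
  have hM : (Matrix.of fun i j : Fin r => ∏ a : Fin h,
        (if decide (σ a ∈ w j) = (decide (a ∈ u i) ^^ decide (a ∈ s)) then (1 : ℂ) else 0)) =
      (1 : Matrix (Fin r) (Fin r) ℂ).submatrix id κ := by
    ext i j
    rw [Matrix.of_apply, prod_twistTable_eq, Matrix.submatrix_apply, Matrix.one_apply, hκ j, id]
    have hinj : Function.Injective fun v : Finset (Fin h) => (symmDiff v s).map σ.toEmbedding :=
      fun v v' hvv => symmDiff_left_injective s (Finset.map_injective _ hvv)
    simp only [hinj.eq_iff, hu.eq_iff, eq_comm]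
  rw [hM, Matrix.det_permute', Matrix.det_one, mul_one]
  exact Int.cast_ne_zero.mpr (Units.ne_zero _)

end

end Summit.ValiantsHypothesis.ValiantsHypothesis.Theorems.BarrierLever.ChowFactor
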